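import Literature.MathematicalPhysics.StatisticalMechanics.StablePotentials
import Literature.MathematicalPhysics.StatisticalMechanics.LennardJonesClusters
import HarnessLib

/-!
# Stability of the Lennard-Jones interaction in dimensions `d ≤ 5` — proof

Topic `Literature/MathematicalPhysics/StatisticalMechanics`. DISCHARGE of the named fact
`Literature.MathematicalPhysics.StatisticalMechanics.lennardJones_stable` of `StablePotentials.lean`:
`lennardJones_stable_holds : lennardJones_stable`, sorry-free, so that users of the fact feed
`lennardJones_stable_holds` for `(h : lennardJones_stable)` (e.g.
`lennardJones_stable.groundStateEnergy_ge lennardJones_stable_holds : ∃ C, ∀ N, −C N ≤ E(N)` in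
`ℝ³`, item `crys_lj_stability` of route `AtomisticToContinuum/CrystalLocalRigidity`).

## Source and what is proved

Blanc–Lewin, *The crystallization conjecture: a review*, EMS Surv. Math. Sci. 2 (2015) 255–306
(arXiv:1504.01153), §1.3 (p. 4): stability (10), `∑_{1 ≤ i < j ≤ N} V(|x_i − x_j|) ≥ −C N` for
all `N` and all configurations, holds for potentials satisfying the Dobrushin (1964) /
Fisher–Ruelle (1966) criterion (12), and "The Lennard-Jones potential (3) satisfies these
conditions in dimensions `d ≤ 5`, and it is therefore stable." BL print no proof (they cite
[Dobrushin-64], [FisRue-66]). The proof below is the elementary closest-pair specialisation of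
that argument to `V_LJ = r⁻¹²/12 − r⁻⁶/6` (the normalisation `r₀ = 1` of `Crystallization.lean`),
with the explicit constant `C = 2³²/12` for every `d ≤ 5`; the hypothesis `d ≤ 5` enters exactly
where (12) needs `∫^∞ r⁻⁶ r^{d−1} dr < ∞`: the number of `r`-separated points in the dyadic shell
of radius `2ᵇ r` grows like `2^{db}` while the pair terms decay like `2^{−6b}`.

## Proof architecture

Reused from `LennardJonesClusters.lean`: the site energies `siteEnergy`, the double-sum form
`two_mul_interactionEnergy_eq_sum_sum`, and the packing bound by volume
`card_le_of_separated_of_dist_le`. Steps: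

1. `interactionEnergy_eq_succAbove_add_siteEnergy`: removing particle `i`,
   `𝓔(x) = 𝓔(x ∘ i.succAbove) + 𝓔ⁱ(x)` (for `V 0 = 0`, which holds for `V_LJ` with `0⁻¹ = 0`).
2. `sum_inv_pow_six_le_of_le_five`: in dimension `d ≤ 5`, if all mutual distances are `≥ r > 0`
   then `∑_{k ≠ i} |xᵢ − x_k|⁻⁶ ≤ 2¹⁶ r⁻⁶` — the dyadic shell `2ᵇ r ≤ |xᵢ − x_k| < 2ᵇ⁺¹ r` holds
   at most `(2ᵇ⁺² + 1)ᵈ ≤ 2⁵ᵇ⁺¹⁵` particles by packing, each contributing `≤ 2⁻⁶ᵇ r⁻⁶`, and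
   `∑_b 2⁻ᵇ ≤ 2` (here `d < 6` is used: the shell count grows like `2^{db}`, the terms decay like
   `2^{-6b}`).
3. `exists_le_siteEnergy_lennardJones`: at a closest pair `(i₀, j₀)`, `r = |x_{i₀} − x_{j₀}|`,
   `𝓔^{i₀}(x) ≥ r⁻¹²/12 − (2¹⁶/6) r⁻⁶ ≥ −2³²/12`.
4. `le_interactionEnergy_lennardJones`: induction on `N`, `𝓔_N(x) ≥ −(2³²/12) N`; whence
   `lennardJones_stable_holds`.
-/

noncomputable section

open scoped BigOperators
open Metric Set Module

namespace Literature.MathematicalPhysics.StatisticalMechanics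

/-! ### Removing one particle -/

section Removal

variable (V : ℝ → ℝ) {d n : ℕ}

/-- The site energy of particle `i` in a configuration of `n + 1` particles, re-indexed over the
`n` other particles through `i.succAbove`. [folklore] -/
theorem siteEnergy_eq_sum_succAbove (x : Fin (n + 1) → EuclideanSpace ℝ (Fin d))
    (i : Fin (n + 1)) :
    siteEnergy V x i = ∑ b : Fin n, V (dist (x i) (x (i.succAbove b))) := by
  have h1 : V (dist (x i) (x i)) + siteEnergy V x i = ∑ k, V (dist (x i) (x k)) :=
    Finset.add_sum_erase _ (fun k => V (dist (x i) (x k))) (Finset.mem_univ i)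
  rw [Fin.sum_univ_succAbove _ i] at h1
  exact add_left_cancel h1

/-- **Removing a particle.** For a potential with `V 0 = 0` (e.g. `V_LJ` with `0⁻¹ = 0`), the
energy of `n + 1` particles is the energy of the `n` particles other than `i` plus the site
energy of `i`: `𝓔(x) = 𝓔(x ∘ i.succAbove) + ∑_{k ≠ i} V(|xᵢ − x_k|)`. [folklore] -/
theorem interactionEnergy_eq_succAbove_add_siteEnergy (hV : V 0 = 0)
    (x : Fin (n + 1) → EuclideanSpace ℝ (Fin d)) (i : Fin (n + 1)) :
    interactionEnergy V x = interactionEnergy V (x ∘ i.succAbove) + siteEnergy V x i := by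
  have h2 := two_mul_interactionEnergy_eq_sum_sum V hV x
  have h2' := two_mul_interactionEnergy_eq_sum_sum V hV (x ∘ i.succAbove)
  have hs := siteEnergy_eq_sum_succAbove V x i
  rw [Fin.sum_univ_succAbove _ i] at h2
  simp only [Fin.sum_univ_succAbove _ i, dist_self, hV, zero_add, Finset.sum_add_distrib] at h2
  simp only [Function.comp_apply] at h2'
  have hsym : ∑ a : Fin n, V (dist (x (i.succAbove a)) (x i)) =
      ∑ b : Fin n, V (dist (x i) (x (i.succAbove b))) :=
    Finset.sum_congr rfl fun a _ => by rw [dist_comm]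
  linarith

end Removal

/-! ### The dyadic shell sum in dimension `d ≤ 5` -/

/-- **Dyadic shell sum** (dimension `d ≤ 5`). If all mutual distances in the configuration `x`
are `≥ r > 0`, then `∑_{k ≠ i} |xᵢ − x_k|⁻⁶ ≤ 2¹⁶ r⁻⁶`: the dyadic shell
`2ᵇ r ≤ |xᵢ − x_k| < 2ᵇ⁺¹ r` contains at most `(2ᵇ⁺² + 1)ᵈ ≤ (2ᵇ⁺³)⁵` particles by the packing
bound `card_le_of_separated_of_dist_le` (using `d ≤ 5`), each contributing `≤ (2ᵇ r)⁻⁶`, so the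
shell contributes `≤ 2¹⁵ · 2⁻ᵇ · r⁻⁶`, and `∑_b 2⁻ᵇ ≤ 2`. (The integrability at infinity of
`r⁻⁶ r^{d-1}`, `d < 6`, in the criterion (12) of Blanc–Lewin 2015.) [folklore] -/
theorem sum_inv_pow_six_le_of_le_five {d N : ℕ} (hd : d ≤ 5)
    (x : Fin N → EuclideanSpace ℝ (Fin d)) {r : ℝ} (hr : 0 < r)
    (hsep : ∀ k l, k ≠ l → r ≤ dist (x k) (x l)) (i : Fin N) :
    ∑ k ∈ Finset.univ.erase i, (dist (x i) (x k))⁻¹ ^ 6 ≤ 65536 * r⁻¹ ^ 6 := by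
  set s := Finset.univ.erase i with hs_def
  set m : Fin N → ℕ := fun k => Nat.log 2 ⌊dist (x i) (x k) / r⌋₊ with hm
  set t := s.image m with ht_def
  have hmem : ∀ k ∈ s, m k ∈ t := fun k hk => Finset.mem_image_of_mem m hk
  have hks : ∀ k ∈ s, r ≤ dist (x i) (x k) := fun k hk =>
    hsep i k (Finset.ne_of_mem_erase hk).symm
  have hfl : ∀ k ∈ s, 1 ≤ ⌊dist (x i) (x k) / r⌋₊ := fun k hk =>
    (Nat.one_le_floor_iff _).2 ((one_le_div hr).2 (hks k hk))
  -- the dyadic shell of `k`: `2^(m k) r ≤ |xᵢ - x_k| < 2^(m k + 1) r`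
  have hmle : ∀ k ∈ s, (2 : ℝ) ^ m k * r ≤ dist (x i) (x k) := fun k hk => by
    have h1 : 2 ^ m k ≤ ⌊dist (x i) (x k) / r⌋₊ :=
      Nat.pow_log_le_self 2 (by have := hfl k hk; omega)
    have h2 : ((2 ^ m k : ℕ) : ℝ) ≤ dist (x i) (x k) / r :=
      (Nat.cast_le.2 h1).trans (Nat.floor_le (div_nonneg dist_nonneg hr.le))
    rw [le_div_iff₀ hr] at h2
    exact_mod_cast h2
  have hmlt : ∀ k ∈ s, dist (x i) (x k) < (2 : ℝ) ^ (m k + 1) * r := fun k hk => by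
    have h1 : ⌊dist (x i) (x k) / r⌋₊ < 2 ^ (m k + 1) := Nat.lt_pow_succ_log_self one_lt_two _
    have h2 : dist (x i) (x k) / r < ⌊dist (x i) (x k) / r⌋₊ + 1 := Nat.lt_floor_add_one _
    have h3 : (⌊dist (x i) (x k) / r⌋₊ : ℝ) + 1 ≤ (2 : ℝ) ^ (m k + 1) := by
      exact_mod_cast h1
    rw [div_lt_iff₀ hr] at h2
    calc dist (x i) (x k) < ((⌊dist (x i) (x k) / r⌋₊ : ℝ) + 1) * r := h2
      _ ≤ (2 : ℝ) ^ (m k + 1) * r := mul_le_mul_of_nonneg_right h3 hr.le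
  -- termwise: `|xᵢ - x_k|⁻⁶ ≤ (2^(m k) r)⁻⁶`
  have step1 : ∑ k ∈ s, (dist (x i) (x k))⁻¹ ^ 6 ≤
      ∑ k ∈ s, r⁻¹ ^ 6 * (((2 : ℝ) ^ m k)⁻¹) ^ 6 := by
    refine Finset.sum_le_sum fun k hk => ?_
    rw [← mul_pow, ← mul_inv]
    have h0 : 0 < r * 2 ^ m k := by positivity
    refine pow_le_pow_left₀ (inv_nonneg.2 dist_nonneg) (inv_anti₀ h0 ?_) _
    rw [mul_comm]
    exact hmle k hk
  -- regroup by shells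
  have step2 : ∑ k ∈ s, r⁻¹ ^ 6 * (((2 : ℝ) ^ m k)⁻¹) ^ 6 =
      ∑ b ∈ t, ((s.filter fun k => m k = b).card : ℝ) * (r⁻¹ ^ 6 * (((2 : ℝ) ^ b)⁻¹) ^ 6) := by
    have := Finset.sum_fiberwise_of_maps_to' hmem (fun b : ℕ => r⁻¹ ^ 6 * (((2 : ℝ) ^ b)⁻¹) ^ 6)
    simp only [Finset.sum_const, nsmul_eq_mul] at this
    exact this.symm
  -- each dyadic shell holds at most `(2^(b+2) + 1)^d ≤ (2^(b+3))^5` particles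
  have step3 : ∀ b ∈ t, ((s.filter fun k => m k = b).card : ℝ) ≤ ((2 : ℝ) ^ (b + 3)) ^ 5 := by
    intro b hb
    set F := s.filter fun k => m k = b with hF
    have hinj : Set.InjOn x F := fun k _ l _ hkl => by
      by_contra hne
      have := hsep k l hne
      rw [hkl, dist_self] at this
      exact absurd this (not_le.2 hr)
    rw [← Finset.card_image_of_injOn hinj]
    have hR : (0 : ℝ) ≤ (2 : ℝ) ^ (b + 1) * r := by positivity
    have hc := card_le_of_separated_of_dist_le (F.image x) (x i) hr hR ?_ ?_
    · rw [finrank_euclideanSpace_fin] at hc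
      have hq : 2 * ((2 : ℝ) ^ (b + 1) * r) / r + 1 = (2 : ℝ) ^ (b + 2) + 1 := by
        field_simp
        ring
      rw [hq] at hc
      have h1 : (1 : ℝ) ≤ (2 : ℝ) ^ (b + 2) + 1 := le_add_of_nonneg_left (by positivity)
      calc ((F.image x).card : ℝ) ≤ ((2 : ℝ) ^ (b + 2) + 1) ^ d := hc
        _ ≤ ((2 : ℝ) ^ (b + 2) + 1) ^ 5 := pow_le_pow_right₀ h1 hd
        _ ≤ ((2 : ℝ) ^ (b + 3)) ^ 5 := by
          refine pow_le_pow_left₀ (by positivity) ?_ 5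
          have h3 : (1 : ℝ) ≤ (2 : ℝ) ^ (b + 2) := one_le_pow₀ (by norm_num)
          calc (2 : ℝ) ^ (b + 2) + 1 ≤ 2 ^ (b + 2) + 2 ^ (b + 2) := by linarith
            _ = (2 : ℝ) ^ (b + 3) := by ring
    · intro c hc
      obtain ⟨k, hk, rfl⟩ := Finset.mem_image.1 hc
      obtain ⟨hks', hkb⟩ := Finset.mem_filter.1 hk
      rw [dist_comm]
      have := hmlt k hks'
      rw [hkb] at this
      exact this.le
    · intro c hc c' hc' hne
      obtain ⟨k, -, rfl⟩ := Finset.mem_image.1 hc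
      obtain ⟨l, -, rfl⟩ := Finset.mem_image.1 hc'
      exact hsep k l fun h => hne (h ▸ rfl)
  -- numerics per shell: `(2^(b+3))^5 · 2^(-6b) r⁻⁶ = 2^15 · 2^(-b) · r⁻⁶`
  have step4 : ∀ b : ℕ, ((2 : ℝ) ^ (b + 3)) ^ 5 * (r⁻¹ ^ 6 * (((2 : ℝ) ^ b)⁻¹) ^ 6) =
      32768 * r⁻¹ ^ 6 * (1 / 2 : ℝ) ^ b := by
    intro b
    have ha : (2 : ℝ) ^ b ≠ 0 := by positivity
    have hinv : (1 / 2 : ℝ) ^ b = ((2 : ℝ) ^ b)⁻¹ := by rw [one_div, inv_pow]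
    have h5 : ((2 : ℝ) ^ b) ^ 5 * (((2 : ℝ) ^ b)⁻¹) ^ 5 = 1 := by
      rw [← mul_pow, mul_inv_cancel₀ ha, one_pow]
    rw [hinv, pow_add]
    linear_combination (32768 * r⁻¹ ^ 6 * ((2 : ℝ) ^ b)⁻¹) * h5
  -- the geometric tail `∑_{b ∈ t} 2^(-b) ≤ 2`
  have step5 : ∑ b ∈ t, (1 / 2 : ℝ) ^ b ≤ 2 := by
    have hsub : t ⊆ Finset.range (t.sup id + 1) := fun b hb =>
      Finset.mem_range.2 (Nat.lt_succ_of_le (Finset.le_sup (f := id) hb))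
    calc ∑ b ∈ t, (1 / 2 : ℝ) ^ b ≤ ∑ b ∈ Finset.range (t.sup id + 1), (1 / 2 : ℝ) ^ b :=
          Finset.sum_le_sum_of_subset_of_nonneg hsub fun b _ _ => by positivity
      _ ≤ 2 := sum_geometric_two_le _
  calc ∑ k ∈ s, (dist (x i) (x k))⁻¹ ^ 6
      ≤ ∑ b ∈ t, ((s.filter fun k => m k = b).card : ℝ) *
          (r⁻¹ ^ 6 * (((2 : ℝ) ^ b)⁻¹) ^ 6) := step1.trans_eq step2
    _ ≤ ∑ b ∈ t, ((2 : ℝ) ^ (b + 3)) ^ 5 * (r⁻¹ ^ 6 * (((2 : ℝ) ^ b)⁻¹) ^ 6) :=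
        Finset.sum_le_sum fun b hb => mul_le_mul_of_nonneg_right (step3 b hb) (by positivity)
    _ = ∑ b ∈ t, 32768 * r⁻¹ ^ 6 * (1 / 2 : ℝ) ^ b := Finset.sum_congr rfl fun b _ => step4 b
    _ = 32768 * r⁻¹ ^ 6 * ∑ b ∈ t, (1 / 2 : ℝ) ^ b := by rw [Finset.mul_sum]
    _ ≤ 32768 * r⁻¹ ^ 6 * 2 := mul_le_mul_of_nonneg_left step5 (by positivity)
    _ = 65536 * r⁻¹ ^ 6 := by ring

/-! ### One particle with bounded site energy, and the induction -/

/-- **A particle with site energy `≥ −2³²/12`.** In dimension `d ≤ 5`, in every configuration of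
`N ≥ 2` distinct points some particle `i₀` has Lennard-Jones site energy
`∑_{k ≠ i₀} V_LJ(|x_{i₀} − x_k|) ≥ −2³²/12`: at a closest pair `(i₀, j₀)`, `r = |x_{i₀} − x_{j₀}|`,
all mutual distances are `≥ r`, so by the dyadic shell sum
`𝓔^{i₀} ≥ r⁻¹²/12 − (2¹⁶/6) r⁻⁶ = ((r⁻⁶ − 2¹⁶)² − 2³²)/12 ≥ −2³²/12`. [folklore] -/
theorem exists_le_siteEnergy_lennardJones {d N : ℕ} (hd : d ≤ 5) [Nontrivial (Fin N)]
    {x : Fin N → EuclideanSpace ℝ (Fin d)} (hx : Function.Injective x) :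
    ∃ i, -(65536 ^ 2 / 12 : ℝ) ≤ siteEnergy lennardJones x i := by
  obtain ⟨i, j, hij⟩ := exists_pair_ne (Fin N)
  -- a closest pair `(i₀, j₀)`
  obtain ⟨p, hp, hmin⟩ := Finset.exists_min_image Finset.univ.offDiag
    (fun p : Fin N × Fin N => dist (x p.1) (x p.2)) ⟨(i, j), by simp [hij]⟩
  obtain ⟨i₀, j₀⟩ := p
  have hij₀ : i₀ ≠ j₀ := by simpa using hp
  set r := dist (x i₀) (x j₀) with hr_def
  have hr : 0 < r := dist_pos.2 (hx.ne hij₀)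
  have hsep : ∀ k l, k ≠ l → r ≤ dist (x k) (x l) := fun k l hkl => hmin (k, l) (by simp [hkl])
  refine ⟨i₀, ?_⟩
  have hS := sum_inv_pow_six_le_of_le_five hd x hr hsep i₀
  have h12 : r⁻¹ ^ 12 ≤ ∑ k ∈ Finset.univ.erase i₀, (dist (x i₀) (x k))⁻¹ ^ 12 := by
    have hj : j₀ ∈ Finset.univ.erase i₀ := Finset.mem_erase.2 ⟨hij₀.symm, Finset.mem_univ _⟩
    exact Finset.single_le_sum (f := fun k => (dist (x i₀) (x k))⁻¹ ^ 12)
      (fun k _ => by positivity) hj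
  have hexp : siteEnergy lennardJones x i₀ =
      (1 / 12) * ∑ k ∈ Finset.univ.erase i₀, (dist (x i₀) (x k))⁻¹ ^ 12 -
        (1 / 6) * ∑ k ∈ Finset.univ.erase i₀, (dist (x i₀) (x k))⁻¹ ^ 6 := by
    simp only [siteEnergy, lennardJones, Finset.sum_sub_distrib, Finset.mul_sum]
  have h12' : r⁻¹ ^ 12 = (r⁻¹ ^ 6) ^ 2 := by ring
  rw [h12'] at h12
  rw [hexp]
  nlinarith [h12, hS, sq_nonneg (r⁻¹ ^ 6 - 65536)]

/-- **Stability of `V_LJ` with an explicit constant.** In dimension `d ≤ 5`, for every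
configuration of `N` distinct points, `𝓔_N(x) = ∑_{i<j} V_LJ(|xᵢ − xⱼ|) ≥ −(2³²/12) N`:
induction on `N`, removing a particle with site energy `≥ −2³²/12`
(`exists_le_siteEnergy_lennardJones`, `interactionEnergy_eq_succAbove_add_siteEnergy`).
This is (10) of Blanc–Lewin 2015 for the Lennard-Jones potential (3), obtained there from the
Dobrushin / Fisher–Ruelle criterion (12). [cite: BlancLewin2015, §1.3 (10) and (12)] -/
theorem le_interactionEnergy_lennardJones {d : ℕ} (hd : d ≤ 5) :
    ∀ (N : ℕ) (x : Fin N → EuclideanSpace ℝ (Fin d)), Function.Injective x →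
      -((65536 ^ 2 / 12 : ℝ) * (N : ℝ)) ≤ interactionEnergy lennardJones x := by
  intro N
  induction N with
  | zero =>
    intro x hx
    rw [interactionEnergy_of_subsingleton]
    simp
  | succ n ih =>
    intro x hx
    rcases Nat.lt_or_ge n 1 with hn | hn
    · haveI : Subsingleton (Fin (n + 1)) := Fin.subsingleton_iff_le_one.2 (by omega)
      rw [interactionEnergy_of_subsingleton]
      exact neg_nonpos.2 (by positivity)
    · haveI : Nontrivial (Fin (n + 1)) := Fin.nontrivial_iff_two_le.2 (by omega)
      obtain ⟨i, hi⟩ := exists_le_siteEnergy_lennardJones hd hx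
      rw [interactionEnergy_eq_succAbove_add_siteEnergy lennardJones lennardJones_zero x i]
      have hih := ih (x ∘ i.succAbove) (hx.comp Fin.succAbove_right_injective)
      push_cast
      linarith

/-- **Discharge of `lennardJones_stable`: the Lennard-Jones potential is stable in dimensions
`d ≤ 5`** (Blanc–Lewin 2015, §1.3: (10) holds for `V_LJ` by the Dobrushin / Fisher–Ruelle
criterion (12), "The Lennard-Jones potential (3) satisfies these conditions in dimensions `d ≤ 5`,
and it is therefore stable"), with `C = 2³²/12` (`le_interactionEnergy_lennardJones`). Users of
the named fact feed `lennardJones_stable_holds` for `(h : lennardJones_stable)`.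
[cite: BlancLewin2015, §1.3 (10) and (12)] -/
theorem lennardJones_stable_holds : lennardJones_stable := fun _ hd =>
  ⟨65536 ^ 2 / 12, le_interactionEnergy_lennardJones hd⟩

end Literature.MathematicalPhysics.StatisticalMechanics

end
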